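import Mathlib
import Summits.MatrixMultiplication.MatrixMultiplication.Theorems.SoloInformedCwTwoValueWeights
import Summits.MatrixMultiplication.MatrixMultiplication.Theorems.SoloInformedCwTwoMixedDependency

/-!
# Door D7 — the `σ = 74` digit system `(1,25 | 4,26 | 6,12)` IS an integer weighted design of `S_3` (kernel certificate)

Solo seat `solo-MatrixMultiplication-informed`, gen 12.  `SoloInformedCwTwoMixedDependency` records that the
polynomial digit products of the system `(s | d) = (1, 4, 6 | 25, 26, 12)` are linearly dependent, but left
its design-hood to two LP engines and a hand certificate.  This file closes that gap in the kernel: with the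
digits `F = ((0,1,25),(0,4,26),(0,6,12))` (cost `σ = 74`) and the NON-NEGATIVE integer weights
`θ = ((4,0,4),(1,4,0),(0,1,1))` (the Gordan vector `y = (-4,0,3,-1,1,1)` of the seat's notes, shifted by a
constant on each coordinate, which changes neither side of the design inequality), every solution in `ℕ` of
`P(u)+P(v)+P(w) = 74` is transversal or has total weight `> h₀(θ) = 15` (`cex_isDoorDesign`; the check is a
`decide` over the `3^9` letter triples: 315 relations, 216 transversal, 99 heavier).  Consequences recorded:
the host bound `bR(T_{cw,2}^{⊠3}) ≤ 75` that this design yields through the integer door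
(`algBorderRank_kroneckerPow_cwTensor_two_le_sigma_succ`; weaker than the classical `64`, stated only to
exhibit the door's output), and the complete kernel form of the refutation of the seat's MD conjecture:
a weighted design whose digit products are linearly dependent (`design_with_dependent_digit_products`).

References: J. Alman, V. Vassilevska Williams, *Limits on all known (and some unknown) approaches to matrix
multiplication*, FOCS 2018, arXiv:1810.08671, Thm 7.2 (weighted monomial degenerations); P. Gordan /
Farkas alternative for the LP form of design-hood (seat notes, sharpest statement §2h(5), §2h(15)).
-/

set_option linter.dupNamespace false

namespace Summit.MatrixMultiplication.MatrixMultiplication.Theorems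

open Literature.Computability.AlgebraicComplexity

/-- The digits `(0, s_k, d_k)` of the `σ = 74` system: rows `(0,1,25), (0,4,26), (0,6,12)`. [new; seat solo-informed, door D7] -/
def cexDigits : Fin 3 → Fin 3 → ℕ := ![![0, 1, 25], ![0, 4, 26], ![0, 6, 12]]

/-- The certifying weights `θ = ((4,0,4),(1,4,0),(0,1,1))`, `h₀(θ) = 15`. [new; seat solo-informed, door D7] -/
def cexWeights : Fin 3 → Fin 3 → ℕ := ![![4, 0, 4], ![1, 4, 0], ![0, 1, 1]]

/-- The digit rows are `(0, cexS k, cexD k)` — the same system as in `SoloInformedCwTwoMixedDependency`. -/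
theorem cexDigits_eq : ∀ k : Fin 3, cexDigits k 1 = cexS k ∧ cexDigits k 2 = cexD k ∧ cexDigits k 0 = 0 := by
  decide

/-- Cost `σ = 74`. -/
theorem digitSigma_cexDigits : digitSigma cexDigits = 74 := by
  simp [digitSigma, cexDigits, Fin.sum_univ_three]

/-- Transversal weight `h₀(θ) = 15`. -/
theorem weightTotal_cexWeights : ∑ k, (cexWeights k 0 + cexWeights k 1 + cexWeights k 2) = 15 := by
  simp [cexWeights, Fin.sum_univ_three]

/-- The finite check behind the certificate: over all `3^9` letter triples, a relation of value `74` is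
transversal in every coordinate or has weight `> 15`. [new; seat solo-informed, door D7; `decide`] -/
theorem cex_key : ∀ a b c a' b' c' a'' b'' c'' : Fin 3,
    cexDigits 0 a + cexDigits 1 b + cexDigits 2 c + (cexDigits 0 a' + cexDigits 1 b' + cexDigits 2 c') +
        (cexDigits 0 a'' + cexDigits 1 b'' + cexDigits 2 c'') = 74 →
      ((a ≠ a' ∧ a ≠ a'' ∧ a' ≠ a'') ∧ (b ≠ b' ∧ b ≠ b'' ∧ b' ≠ b'') ∧ (c ≠ c' ∧ c ≠ c'' ∧ c' ≠ c'')) ∨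
        15 < cexWeights 0 a + cexWeights 1 b + cexWeights 2 c +
          (cexWeights 0 a' + cexWeights 1 b' + cexWeights 2 c') +
          (cexWeights 0 a'' + cexWeights 1 b'' + cexWeights 2 c'') := by
  decide

/-- **The `σ = 74` system is an integer weighted design of `S_3`.** [new; seat solo-informed, door D7;
completes the refutation in `SoloInformedCwTwoMixedDependency`] -/
theorem cex_isDoorDesign :
    IsDoorDesign (N := 3) (fun k j => (cexDigits k j : ℤ)) cexWeights := by
  intro u v w hrel
  rw [wordSum_natCast, wordSum_natCast, wordSum_natCast, sigma_natCast] at hrel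
  have h : (∑ k, cexDigits k (u k)) + (∑ k, cexDigits k (v k)) + (∑ k, cexDigits k (w k)) =
      digitSigma cexDigits := by exact_mod_cast hrel
  rw [digitSigma_cexDigits] at h
  rw [weightTotal_cexWeights]
  simp only [wordWt, Fin.sum_univ_three] at h ⊢
  rcases cex_key (u 0) (u 1) (u 2) (v 0) (v 1) (v 2) (w 0) (w 1) (w 2) h with ht | hw
  · left
    intro k
    fin_cases k
    · exact ht.1
    · exact ht.2.1
    · exact ht.2.2
  · exact Or.inr hw

/-- The door's output for this design: `bR(T_{cw,2}^{⊠3}) ≤ σ + 1 = 75` via the host `ℂ[x]/(x^75)`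
(weaker than the classical `64`; recorded to exhibit the mechanism). [new; seat solo-informed, door D7] -/
theorem algBorderRank_cwTensor_two_pow_three_le_75 :
    algBorderRank (kroneckerPow (cwTensor ℂ 2) 3) ≤ 75 := by
  have h := algBorderRank_kroneckerPow_cwTensor_two_le_sigma_succ _ _ cex_isDoorDesign
  simpa [digitSigma_cexDigits] using h

/-- **Complete kernel refutation of MD.** There is an integer weighted design of `S_3` — digits
`(0, cexS k, cexD k)`, weights `cexWeights` — whose polynomial digit products `mixedProd cexS cexD ![]` are
linearly dependent over `ℚ`. [new; seat solo-informed, door D7; refutes CLAIMS c124(c)/c126 in the kernel] -/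
theorem design_with_dependent_digit_products :
    IsDoorDesign (N := 3) (fun k j => ((![0, cexS k, cexD k] : Fin 3 → ℕ) j : ℤ)) cexWeights ∧
      ¬ LinearIndependent ℚ (mixedProd cexS cexD ![]) := by
  refine ⟨?_, not_linearIndependent_mixedProd_cex⟩
  have hF : (fun k j => ((![0, cexS k, cexD k] : Fin 3 → ℕ) j : ℤ)) = fun k j => (cexDigits k j : ℤ) := by
    funext k j
    fin_cases k <;> fin_cases j <;> rfl
  rw [hF]
  exact cex_isDoorDesign

end Summit.MatrixMultiplication.MatrixMultiplication.Theorems
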